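import Mathlib.LinearAlgebra.FiniteDimensional.Lemmas
import Mathlib.LinearAlgebra.Dual.Lemmas
import Mathlib.LinearAlgebra.Trace
import HarnessLib

/-!
# `Hom(U, U′)` has no proper non-zero subspace stable under left multiplication by `𝔰𝔩(U′)` and right multiplication by `𝔰𝔩(U)` (`dim U, dim U′ ≥ 2`)

Topic `Literature/Algebra/Lie` (namespace `Literature.Algebra.Lie`). THEOREMS ONLY (no definition, no instance, no named fact, no `sorry`). Written
for the cell `pub-hodgeav-hg6` (req-37 (A) Q2b; eng-4 g7; the input of the LIFT branch S3 of the (3|3) WEIL square,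
`HOME/jobs/WEIL33-eng4g7/DESIGN.md` REV 2 §5: once every traceless endomorphism of `W⁺` (resp. `W⁻`) lifts to `(Lie Hg)_ℂ` with zero
restriction to `W⁻` (resp. `W⁺`), the raising corner `𝔊⁺|_W ⊆ Hom(W⁻, W⁺)` is closed under `Z ∘ –` and `– ∘ Z′` for traceless `Z`, `Z′`,
hence is everything). HONEST FRAMING: pure linear algebra; nothing here is about Hodge theory or HC.

THE STATEMENT (**`eq_top_of_forall_traceless_comp_mem`**). `K` a field, `U`, `U′` finite-dimensional with `dim U ≥ 2`, `dim U′ ≥ 2`;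
`S ⊆ Hom_K(U, U′)` a NON-ZERO subspace with `Z ∘ G ∈ S` for every `G ∈ S` and traceless `Z ∈ End(U′)`, and `G ∘ Z′ ∈ S` for every traceless
`Z′ ∈ End(U)`. Then `S = Hom_K(U, U′)`. (The outer tensor product `U′ ⊗ U^*` of the standard representations of `𝔰𝔩(U′)` and `𝔰𝔩(U)` is
irreducible — Goodman–Wallach §4.2.1; here by matrix units as in Humphreys §19.2: from `0 ≠ G₀ ∈ S` and `G₀ w₀ = p₀ ≠ 0`, the traceless
rank-one operators `α ⊗ x` (`α(p₀) = 1`, `α(x) = 0`) and `ξ ⊗ w₀ − ξ(w₀) ξ₂ ⊗ w₂` produce every rank-one `ξ ⊗ x` inside `S`.)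

## References

* [GoodmanWallachGTM255] R. Goodman, N. R. Wallach, *Symmetry, Representations, and Invariants*, GTM 255, §4.1.1 and §4.2.1 (irreducibility
  of outer tensor products; matrix algebras).
* [Humphreys1972] J. E. Humphreys, GTM 9, §19.2 (matrix units from rank-one operators).
-/

namespace Literature.Algebra.Lie

open Module

variable {K : Type*} [Field K] {U U' : Type*} [AddCommGroup U] [Module K U] [AddCommGroup U'] [Module K U']
  [FiniteDimensional K U] [FiniteDimensional K U']

omit [FiniteDimensional K U'] in
/-- A functional separating `y` from the line `K ∙ x`: `α y = 1`, `α x = 0` (for `y ∉ K ∙ x`). [folklore] -/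
private theorem exists_dual_eq_one_eq_zero {x y : U'} (hy : y ∉ K ∙ x) : ∃ α : Module.Dual K U', α y = 1 ∧ α x = 0 := by
  obtain ⟨f, hfy, hfx⟩ := Submodule.exists_dual_map_eq_bot_of_notMem hy inferInstance
  have hfx0 : f x = 0 := by
    have h : f x ∈ Submodule.map f (K ∙ x) := Submodule.mem_map_of_mem (Submodule.mem_span_singleton_self x)
    rw [hfx] at h
    exact (Submodule.mem_bot K).1 h
  refine ⟨(f y)⁻¹ • f, ?_, ?_⟩
  · rw [LinearMap.smul_apply, smul_eq_mul, inv_mul_cancel₀ hfy]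
  · rw [LinearMap.smul_apply, hfx0, smul_zero]

/-- A traceless endomorphism moving `x ≠ 0` to any `y ∉ K ∙ x`: `α ⊗ y` with `α x = 1`, `α y = 0`. [folklore] -/
private theorem exists_traceless_apply_eq {x y : U'} (hx : x ≠ 0) (hy : y ∉ K ∙ x) :
    ∃ Z : Module.End K U', LinearMap.trace K U' Z = 0 ∧ Z x = y := by
  have hx' : x ∉ K ∙ y := by
    intro h
    obtain ⟨c, rfl⟩ := Submodule.mem_span_singleton.1 h
    rcases eq_or_ne c 0 with hc | hc
    · exact hx (by rw [hc, zero_smul])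
    · exact hy (Submodule.mem_span_singleton.2 ⟨c⁻¹, by rw [smul_smul, inv_mul_cancel₀ hc, one_smul]⟩)
  obtain ⟨α, hαx, hαy⟩ := exists_dual_eq_one_eq_zero hx'
  exact ⟨α.smulRight y, by rw [LinearMap.trace_smulRight, hαy], by rw [LinearMap.smulRight_apply, hαx, one_smul]⟩

omit [FiniteDimensional K U'] in
/-- A vector outside a line exists when `dim ≥ 2`. [folklore] -/
private theorem exists_not_mem_span_singleton [FiniteDimensional K U'] (h2 : 1 < Module.finrank K U') (x : U') :
    ∃ y : U', y ∉ K ∙ x := by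
  by_contra h
  push Not at h
  have htop : (K ∙ x) = ⊤ := Submodule.eq_top_iff'.2 h
  have hle : Module.finrank K U' ≤ 1 := by
    rw [← finrank_top, ← htop]
    exact (finrank_span_le_card ({x} : Set U')).trans (by simp)
  omega

set_option maxHeartbeats 800000 in
/-- **`Hom(U, U′)` is simple under traceless left and right multiplications** (`dim U, dim U′ ≥ 2`): a non-zero subspace
`S ⊆ Hom_K(U, U′)` with `𝔰𝔩(U′) ∘ S ⊆ S` and `S ∘ 𝔰𝔩(U) ⊆ S` is everything (irreducibility of the outer tensor product `U′ ⊗ U^*`).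
[cite: GoodmanWallachGTM255, §4.2.1] [cite: Humphreys1972, §19.2] -/
theorem eq_top_of_forall_traceless_comp_mem (hU : 1 < Module.finrank K U) (hU' : 1 < Module.finrank K U')
    {S : Submodule K (U →ₗ[K] U')} (hne : S ≠ ⊥)
    (hleft : ∀ Z : Module.End K U', LinearMap.trace K U' Z = 0 → ∀ G ∈ S, Z ∘ₗ G ∈ S)
    (hright : ∀ Z : Module.End K U, LinearMap.trace K U Z = 0 → ∀ G ∈ S, G ∘ₗ Z ∈ S) : S = ⊤ := by
  classical
  -- a non-zero `G₀ ∈ S`, `w₀` with `p₀ = G₀ w₀ ≠ 0`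
  obtain ⟨G₀, hG₀S, hG₀⟩ := (Submodule.ne_bot_iff S).1 hne
  obtain ⟨w₀, hp₀⟩ : ∃ w₀, G₀ w₀ ≠ 0 := by
    by_contra h
    push Not at h
    exact hG₀ (LinearMap.ext h)
  set p₀ := G₀ w₀ with hp₀def
  -- (1) a rank-one element `β₁ ⊗ x₁ ∈ S` with `β₁ w₀ = 1`, for some `x₁ ∉ K ∙ p₀`
  obtain ⟨x₁, hx₁⟩ := exists_not_mem_span_singleton hU' p₀
  have hx₁0 : x₁ ≠ 0 := fun h => hx₁ (by rw [h]; exact Submodule.zero_mem _)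
  obtain ⟨Z₁, hZ₁tr, hZ₁x⟩ := exists_traceless_apply_eq (K := K) hp₀ hx₁
  obtain ⟨α₁, hα₁p, hα₁x⟩ : ∃ α₁ : Module.Dual K U', α₁ p₀ = 1 ∧ α₁ x₁ = 0 := by
    have h : p₀ ∉ K ∙ x₁ := by
      intro h
      obtain ⟨c, hc⟩ := Submodule.mem_span_singleton.1 h
      rcases eq_or_ne c 0 with h0 | h0
      · exact hp₀ (by rw [← hc, h0, zero_smul])
      · exact hx₁ (Submodule.mem_span_singleton.2 ⟨c⁻¹, by rw [← hc, smul_smul, inv_mul_cancel₀ h0, one_smul]⟩)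
    exact exists_dual_eq_one_eq_zero h
  set β₁ : Module.Dual K U := α₁ ∘ₗ G₀ with hβ₁
  have hβ₁w₀ : β₁ w₀ = 1 := by rw [hβ₁, LinearMap.comp_apply, ← hp₀def, hα₁p]
  have hR₁ : β₁.smulRight x₁ ∈ S := by
    have h := hleft (α₁.smulRight x₁) (by rw [LinearMap.trace_smulRight, hα₁x]) G₀ hG₀S
    have heq : α₁.smulRight x₁ ∘ₗ G₀ = β₁.smulRight x₁ := LinearMap.ext fun u => by
      rw [LinearMap.comp_apply, LinearMap.smulRight_apply, LinearMap.smulRight_apply, hβ₁, LinearMap.comp_apply]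
    rwa [heq] at h
  -- (2) right moves: `ξ ⊗ x₁ ∈ S` for every `ξ`
  obtain ⟨w, hw⟩ := exists_not_mem_span_singleton (K := K) (U' := U) hU w₀
  set w₂ := w - β₁ w • w₀ with hw₂
  have hβ₁w₂ : β₁ w₂ = 0 := by rw [hw₂, map_sub, map_smul, hβ₁w₀, smul_eq_mul, mul_one, sub_self]
  have hw₂0 : w₂ ≠ 0 := fun h => hw (Submodule.mem_span_singleton.2 ⟨β₁ w, by rw [hw₂, sub_eq_zero] at h; exact h.symm⟩)
  obtain ⟨ξ₂, hξ₂w₂, -⟩ : ∃ ξ₂ : Module.Dual K U, ξ₂ w₂ = 1 ∧ ξ₂ 0 = 0 :=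
    exists_dual_eq_one_eq_zero (K := K) (U' := U) (x := 0) (y := w₂) (by
      rw [Submodule.span_singleton_eq_bot.2 rfl, Submodule.mem_bot]; exact hw₂0)
  have hrank1 : ∀ ξ : Module.Dual K U, ξ.smulRight x₁ ∈ S := by
    intro ξ
    set Z' : Module.End K U := ξ.smulRight w₀ - (ξ w₀) • ξ₂.smulRight w₂ with hZ'
    have hZ'tr : LinearMap.trace K U Z' = 0 := by
      rw [hZ', map_sub, map_smul, LinearMap.trace_smulRight, LinearMap.trace_smulRight, hξ₂w₂, smul_eq_mul, mul_one, sub_self]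
    have h := hright Z' hZ'tr _ hR₁
    have heq : β₁.smulRight x₁ ∘ₗ Z' = ξ.smulRight x₁ := LinearMap.ext fun u => by
      rw [LinearMap.comp_apply, LinearMap.smulRight_apply, LinearMap.smulRight_apply, hZ', LinearMap.sub_apply,
        LinearMap.smul_apply, LinearMap.smulRight_apply, LinearMap.smulRight_apply, map_sub, map_smul, map_smul, map_smul,
        hβ₁w₀, hβ₁w₂, smul_eq_mul, mul_one, smul_eq_mul, smul_eq_mul, mul_zero, mul_zero, sub_zero]
    rwa [heq] at h
  -- (3) left moves: `ξ ⊗ x ∈ S` for every `x`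
  have hrank : ∀ (ξ : Module.Dual K U) (x : U'), ξ.smulRight x ∈ S := by
    intro ξ x
    have hmove : ∀ {y z : U'}, y ≠ 0 → z ∉ K ∙ y → ξ.smulRight y ∈ S → ξ.smulRight z ∈ S := by
      intro y z hy hz hS
      obtain ⟨Z, hZtr, hZy⟩ := exists_traceless_apply_eq (K := K) hy hz
      have h := hleft Z hZtr _ hS
      have heq : Z ∘ₗ ξ.smulRight y = ξ.smulRight z := LinearMap.ext fun u => by
        rw [LinearMap.comp_apply, LinearMap.smulRight_apply, LinearMap.smulRight_apply, map_smul, hZy]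
      rwa [heq] at h
    by_cases hx : x ∈ K ∙ x₁
    · obtain ⟨c, rfl⟩ := Submodule.mem_span_singleton.1 hx
      rcases eq_or_ne c 0 with hc | hc
      · rw [hc, zero_smul]
        have h0 : ξ.smulRight (0 : U') = 0 := LinearMap.ext fun u => by rw [LinearMap.smulRight_apply, smul_zero, LinearMap.zero_apply]
        rw [h0]; exact S.zero_mem
      · -- two moves: `x₁ ↦ x' ↦ c • x₁`
        obtain ⟨x', hx'⟩ := exists_not_mem_span_singleton hU' x₁
        have hx'0 : x' ≠ 0 := fun h => hx' (by rw [h]; exact Submodule.zero_mem _)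
        have hcx : c • x₁ ∉ K ∙ x' := by
          intro h
          obtain ⟨a, ha⟩ := Submodule.mem_span_singleton.1 h
          rcases eq_or_ne a 0 with ha0 | ha0
          · rw [ha0, zero_smul] at ha
            exact hx₁0 ((smul_eq_zero.1 ha.symm).resolve_left hc)
          · exact hx' (Submodule.mem_span_singleton.2 ⟨a⁻¹ * c, by
              rw [← smul_smul, ← ha, smul_smul, inv_mul_cancel₀ ha0, one_smul]⟩)
        exact hmove hx'0 hcx (hmove hx₁0 hx' (hrank1 ξ))
    · exact hmove hx₁0 hx (hrank1 ξ)
  -- (4) rank-one operators span `Hom(U, U′)`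
  rw [eq_top_iff]
  rintro F -
  set b := Module.finBasis K U with hb
  have hexp : F = ∑ i, (b.coord i).smulRight (F (b i)) := by
    refine LinearMap.ext fun u => ?_
    rw [LinearMap.sum_apply]
    simp only [LinearMap.smulRight_apply]
    conv_lhs => rw [← b.sum_repr u]
    rw [map_sum]
    refine Finset.sum_congr rfl fun i _ => ?_
    rw [map_smul, Module.Basis.coord_apply]
  rw [hexp]
  exact Submodule.sum_mem _ fun i _ => hrank _ _

end Literature.Algebra.Lie
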